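import Summits.QuantumFields.YangMills.Theorems.BalabanUVNodesN15SiteScalarLayerDressedSized
import Summits.QuantumFields.YangMills.Theorems.BalabanUVNodesN15FullPropagatorV1XSizedN15At
import HarnessLib

/-!
# Route «BalabanUVNodes», cluster K4 «SpineRates» — node N15 = NE2: THE SITE LAYER WITH THE BACKGROUND LIVE IN THE TwoGrid ENTRY CURRENCY, XII — A `Live` SIZE-LIVE FAMILY WITH
# OPERATOR AND SITE LAYERS READING THE BACKGROUND: dag-n15-c FILE 40's sized gauge-dressed family `fgInstanceV1GS` (dag-n15-a S-E's `v1XAS`, «the best N15 inhabitant in the tree»)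
# with its U-blind site kernel REPLACED by part IV's dressed site socket at THE massless scalar site propagator dressed (dag-n15-c S4) by a scalar-site species reading an abelian
# component `φ ∘ A′` of the gauge field — `PairedFamilyGuard.Live ∧ N15At` on the sub-index `m ≥ 1`

Cell `pub-ymgap`, WIDTH SEAT `pub-ymgap-dag-n15-w1` (generation 2; director-ym №197 ∕ HUMAN RULING D-0149; chair R455 (A) ∕ R461; plan g81∕g82 `W-SEAT-START-LIST.md` §n15).  `bears_on:
R4∕N15 · K3⁷ SpineGivenEndpointR13SepCoPH (stmt-QuantumFields-20544)`.  Filed `--supports stmt-QuantumFields-20544 --as helper` — COUNT-NEUTRAL.  Six plumbing `def`s (the species and the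
(3.65) site perturbation matrices of the two runs, the sub-index, the `NE2Objects₁₁` literal), the rest theorems; 0 `sorry`.  Imports this seat's part XI `…N15SiteScalarLayerDressedSized`
(`ne2PlusSite_sSiteExOn_of_sizedSpeciesLetters`) and dag-n15-a S-E `…N15FullPropagatorV1XSizedN15At` (`n15At_v1XAS`, `v1CovS`, `reg_zero_fgInstanceV1GS`; through it FILE 40
`fgInstanceV1GS`∕`fgFamilyV1XAS`, S-D `live_opGeoS`, n15-b `unstack`∕`hasMaj_unstack`∕`hasMaj_idef_unstack`, 13c `blockAvgV`∕`fit_blockAvgV`∕`norm_blockAvgV_le`, F4 `fibre_conn_kingPrV`)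
BY NAME; nothing in the tree is modified.

THE SPECIES (MODEL, said plainly).  FILE 40's fine configuration is a gauge field `A′ : Fin (d+1) → (fine bonds) → 𝔄` in the (3.35) window READ AT SIZE `M` (`‖A′‖ ≤ c₃₅Mα₀`,
`‖A′(b + e_κ) − A′(b)‖ ≤ c₃₅Mα₀η′`); the coarse partner its King block average `gavgM`.  The scalar-site species reads an ABELIAN COMPONENT of it on the bonds out of each site:
`V̂(A′)λ̂(x) = Σ_μ φ(A′_μ(x,μ))·λ̂(x, some μ)` (n15-b's `unstack` with `c = 0`), `φ : 𝔄 →L[ℝ] ℝ` any functional with `|φ a| ≤ ‖a‖` (a datum) — [B9] (3.52)'s first-order shape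
`Σ_μ M_{a_μ}N∇_μ` with `ad A′` replaced by a scalar component (no colour on the scalar site propagator; the coloured `G′ ⊗ 1_𝔤` site layer is the honest upgrade, not typed).
Its three diagonal letters AT SIZE are theorems of the family's `Reg335`: sizes `≤ (d+2)c₃₅Mα₀`, fit `≤ 2(d+1)(d+2)c₃₅Mα₀·L^{−k}` (King-fibre oscillation `fibre_conn_kingPrV` from the
shift letters + `fit_blockAvgV`).

CONTENTS.  §1 defs `v1SiteSpeciesF∕C`, `v1SitePertF∕C`; §2 ★ `v1SiteSpecies_letters` (the three sized diagonal letters from `Reg335`; `K_sp = 2(d+1)(d+2)c₃₅`); §3 `V1IndexSM d` (`m ≥ 1`),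
`v1IndexSM_nonempty`, `v1IndexSM_cofinal`; §6 the `NE2Objects₁₁` literal `v1XASiteObjects` + faces incl. the keyed-home face `s_N15_of_admits_v1XASite_family`; §4 ★★ `ne2PlusSite_v1XAS_site` (part XI §3 ∘ §2); §5 ★★★ **`n15At_v1XAS_site`** (OPERATOR = FILE 40 `fgFamilyV1XAS` — background LIVE through
the (3.52) species, all four (3.42) entries covariant; SITE = the dressed socket — background LIVE; UNIT = S-E's `v1CovS` — U-blind, said), ★★★ **`live_and_n15At_v1XAS_site`** (S-D
`live_opGeoS`: size ∕ scale count cofinal on the sub-index, trivial field regular).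

HONEST FRAMING.  Count-neutral KNIT; no new estimate.  MODEL-LEVEL in the site species (abelian component `φ ∘ A′`, no parallel transport ∕ colour on the site propagator) exactly as
FILE 40's operator species is model-level (abelianised∕matrix (3.52) reading); sub-index `m ≥ 1`; `F₂` dropped; unit layer U-blind.  GENUINE ∕ PRINTED-SHAPE: the sized window
`c₃₅Mα₀` and smallness `Mα₀ ≤ a₀` (Thm 3.1∕3.2 «for M ≥ M₁»), the massless scalar site propagator and its site form `Q′G′²Q′*` (part VII), King's pairing, the guard `Live`.  NOT [B9]
Thms 3.1∕3.2∕3.15 at a general (3.35)-regular `U` (NE2⁺ NOT PRINTED as an η-rate); Node 00's [B9] layers of record are residual — **N15 is NOT discharged** (typed 28∕28 · discharged 5∕27 of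
record unchanged); K3⁷'s N15 pin is `fullGSizedObjects` (untouched; this family is a CANDIDATE for a later re-pin, the plan's call); one finite four-torus programme at fixed `ε` —
NOT ℝ⁴, NOT infinite volume, NOT OS, NOT a mass gap, NOT Clay; R4 closes the conditional finite-𝕋⁴ rung `BalabanLadder.UV` only.  Restate-immune.
-/

set_option autoImplicit false

noncomputable section

open scoped BigOperators Matrix
open Finset

namespace Summit.QuantumFields.YangMills.BalabanUVNodes.N15.SiteLayerBg

open Literature.MathematicalPhysics.QuantumFieldTheory.Balaban1983to89
open Literature.MathematicalPhysics.QuantumFieldTheory.Balaban1983to89.B11SectG (BlockNorm HasMaj)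
open Literature.MathematicalPhysics.QuantumFieldTheory.Balaban1983to89.T4EtaRate (PairedInstance EtaPairing NE2PlusOperator NE2PlusSite NE2PlusUnit)
open Literature.MathematicalPhysics.QuantumFieldTheory.Balaban1983to89.T4EtaRateDefect (idef)
open Literature.MathematicalPhysics.QuantumFieldTheory.Balaban1983to89.T4EtaRateCoeffDefect (pull diagK diagK_nonneg diagK_mono fibre)
open Literature.MathematicalPhysics.QuantumFieldTheory.Balaban1983to89.B5Prop11Plancherel (Tor fine)
open Literature.MathematicalPhysics.QuantumFieldTheory.Balaban1983to89.B4Sect5Torus (tdist)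
open Literature.MathematicalPhysics.QuantumFieldTheory.Balaban1983to89.B5QGGQ145Bounds (Idx)
open Literature.MathematicalPhysics.QuantumFieldTheory.Balaban1983to89.B6UnitTorusCarrier (unitTorusGeo)
open Literature.MathematicalPhysics.QuantumFieldTheory.Balaban1983to89.NE2NodeTorus (ne2PlusOperator_reindex ne2PlusUnit_reindex)
open Literature.MathematicalPhysics.QuantumFieldTheory.King1986 (aK)
open Literature.MathematicalPhysics.QuantumFieldTheory.King1986.Torus (blockOf tdistT)
open Summit.QuantumFields.YangMills.BalabanUVNodes.N15.VectorPiece (unitTorusGeoS kingPr kingPrV bshiftEquiv blkFine fibre_conn_kingPrV)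
open Summit.QuantumFields.YangMills.BalabanUVNodes.N15.OperatorReadout (opGeo)
open Summit.QuantumFields.YangMills.BalabanUVNodes.N15.MatrixSpecies (liftBlk blockAvgV fit_blockAvgV norm_blockAvgV_le)
open Summit.QuantumFields.YangMills.BalabanUVNodes.N15.TwoGrid (TGIndex)
open Summit.QuantumFields.YangMills.BalabanUVNodes.N15.BackgroundLayer (unstack blkPair liftPair hasMaj_unstack hasMaj_idef_unstack inv_pow_le_rate gavgM fgInstanceV1GS fgFamilyV1XAS)
open Summit.QuantumFields.YangMills.BalabanUVNodes.N15.SiteLayer (dressedOp)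
open Summit.QuantumFields.YangMills.BalabanUVNodes.N15.GenuineRecord (TGIndexS n15At_v1XAS v1CovS reg_zero_fgInstanceV1GS geoS live_opGeoS)
open Summit.QuantumFields.YangMills.BalabanUVNodes.N15.PairedFamilyGuard (Live)
open Summit.QuantumFields.YangMills.BalabanUVNodes.N15KingModelRung.Curved (kingGOp kingDOp underPtN)
open Literature.MathematicalPhysics.QuantumFieldTheory.Balaban1983to89.T4Continuum (T4Family ULoop)
open Summit.QuantumFields.BalabanUV.T4Continuum.HistoryFlow (two_le_L)
open Summit.QuantumFields.YangMills.BalabanUVNodes.N15.AtKeyedHome (s_N15_of_admits neZero_blockFactor)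
open YMDAG.UVSplit (Datum RateCarriers RateRecordPred N15At S_N15 ne2OfRecord₁₁)

variable {d : ℕ} {L : ℕ} [NeZero L]
variable (d) (𝔄 : Type) [NormedRing 𝔄] [NormedAlgebra ℝ 𝔄] [CompleteSpace 𝔄] (ι : Type) [Fintype ι] [DecidableEq ι] [Nonempty ι] (e : 𝔄 ≃L[ℝ] (ι → ℝ)) (φ : 𝔄 →L[ℝ] ℝ)

/-! ## §1 The scalar-site species reading an abelian component of the gauge field; the dressed site perturbations -/

section Species

/-- THE SCALAR-SITE SPECIES OF THE FINE RUN at index `(j, ν)`: `V̂(A′)λ̂(x) = Σ_μ φ(A′_μ(x,μ))·λ̂(x, some μ)` — n15-b's `unstack` with `c = 0`, the coefficient of the derived piece `D_μ`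
being the abelian component `φ` of the gauge field on the bond `(x, μ)` (MODEL). [cite: Balaban1985BackgroundPropagators, (3.52) p.400 (first-order perturbation: shape)] -/
def v1SiteSpeciesF (hL : Odd L ∧ 1 < L) (j : TGIndexS × Fin (d + 1)) (A : (fgInstanceV1GS d 𝔄 ι hL j).Bf.Cfg) :
    (Tor (fine (L ^ j.1.m * L ^ j.1.k) (TGIndex.Mn d hL j.1.toTGIndex)) × Option (Fin (d + 1)) → ℝ) →ₗ[ℝ] (Tor (fine (L ^ j.1.m * L ^ j.1.k) (TGIndex.Mn d hL j.1.toTGIndex)) → ℝ) :=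
  unstack (fun _ => 0) (fun μ x => φ (A μ (x, μ)))

/-- THE SCALAR-SITE SPECIES OF THE COARSE RUN at `(j, ν)` (same reading of a coarse gauge field). [cite: Balaban1985BackgroundPropagators, (3.52) p.400 (shape)] -/
def v1SiteSpeciesC (hL : Odd L ∧ 1 < L) (j : TGIndexS × Fin (d + 1)) (B : (fgInstanceV1GS d 𝔄 ι hL j).Bc.Cfg) :
    (Tor (fine (L ^ j.1.k) (TGIndex.Mn d hL j.1.toTGIndex)) × Option (Fin (d + 1)) → ℝ) →ₗ[ℝ] (Tor (fine (L ^ j.1.k) (TGIndex.Mn d hL j.1.toTGIndex)) → ℝ) :=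
  unstack (fun _ => 0) (fun μ x => φ (B μ (x, μ)))

/-- THE FINE RUN's (3.65) SITE PERTURBATION MATRIX: `siteEntries (Q(X(X − G′) + (X − G′)G′)Q*)`, `G′ = kingGOp L a_S 0 (k+m) (L^mL^k) M` THE massless scalar site propagator of the
fine run, `X = dressedOp G′ D V̂(A′)`. [cite: Balaban1985BackgroundPropagators, (3.65) p.403 (shape)] -/
def v1SitePertF (hL : Odd L ∧ 1 < L) (aS : ℝ) (j : TGIndexS × Fin (d + 1)) (A : (fgInstanceV1GS d 𝔄 ι hL j).Bf.Cfg) :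
    Matrix (Idx (TGIndex.Mn d hL j.1.toTGIndex)) (Idx (TGIndex.Mn d hL j.1.toTGIndex)) ℝ :=
  siteEntries (TGIndex.Mn d hL j.1.toTGIndex) (sitePert365 (TGIndex.Mn d hL j.1.toTGIndex)
    (blockOf (L ^ j.1.k) (TGIndex.Mn d hL j.1.toTGIndex) ∘ underPtN L j.1.k j.1.m (TGIndex.Mn d hL j.1.toTGIndex))
    (kingGOp L aS 0 (j.1.k + j.1.m) (L ^ j.1.m * L ^ j.1.k) (TGIndex.Mn d hL j.1.toTGIndex))
    (dressedOp (kingGOp L aS 0 (j.1.k + j.1.m) (L ^ j.1.m * L ^ j.1.k) (TGIndex.Mn d hL j.1.toTGIndex))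
      (fun μ => kingDOp L aS 0 (j.1.k + j.1.m) (L ^ j.1.m * L ^ j.1.k) (TGIndex.Mn d hL j.1.toTGIndex) μ) (v1SiteSpeciesF d 𝔄 ι φ hL j A)))

/-- THE COARSE RUN's (3.65) SITE PERTURBATION MATRIX (`G′ = kingGOp L a_S 0 k (L^k) M`). [cite: Balaban1985BackgroundPropagators, (3.65) p.403 (shape)] -/
def v1SitePertC (hL : Odd L ∧ 1 < L) (aS : ℝ) (j : TGIndexS × Fin (d + 1)) (B : (fgInstanceV1GS d 𝔄 ι hL j).Bc.Cfg) :
    Matrix (Idx (TGIndex.Mn d hL j.1.toTGIndex)) (Idx (TGIndex.Mn d hL j.1.toTGIndex)) ℝ :=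
  siteEntries (TGIndex.Mn d hL j.1.toTGIndex) (sitePert365 (TGIndex.Mn d hL j.1.toTGIndex) (blockOf (L ^ j.1.k) (TGIndex.Mn d hL j.1.toTGIndex))
    (kingGOp L aS 0 j.1.k (L ^ j.1.k) (TGIndex.Mn d hL j.1.toTGIndex))
    (dressedOp (kingGOp L aS 0 j.1.k (L ^ j.1.k) (TGIndex.Mn d hL j.1.toTGIndex)) (fun μ => kingDOp L aS 0 j.1.k (L ^ j.1.k) (TGIndex.Mn d hL j.1.toTGIndex) μ)
      (v1SiteSpeciesC d 𝔄 ι φ hL j B)))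

end Species

/-! ## §2 ★ The species' three diagonal letters AT SIZE from FILE 40's `Reg335` -/

section Letters

omit [CompleteSpace 𝔄] [DecidableEq ι] [Nonempty ι] in
/-- ★ **THE THREE DIAGONAL LETTERS OF THE SCALAR-SITE SPECIES AT SIZE.**  For `c₃₅ ≥ 0`, `γ ≤ 2`, a functional `|φ a| ≤ ‖a‖`, an index `(j, ν)`, `α₀ > 0` and a fine gauge field `A′`
in FILE 40's (3.35) window at `(c₃₅, α₀)` (letters `‖A′‖ ≤ c₃₅M_jα₀`, `‖A′(b + e_κ) − A′(b)‖ ≤ c₃₅M_jα₀·η′`, `η′ = L^{−k}L^{−m}`): `V̂_c(Ā′) ≤ diagK (K_sp (M_jα₀))` on King's blocks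
(`norm_blockAvgV_le`), `V̂_f(A′) ≤ diagK (K_sp (M_jα₀))` on `blockOf ∘ underPtN`, and the fit `𝔇(V̂_f(A′), V̂_c(Ā′)) ≤ diagK (K_sp (M_jα₀)(L^k)^{−γ∕2})` through `(pull (liftPair π), pull π)`
(`fibre_conn_kingPrV`: fibre oscillation `≤ 2(d+1)(L^m − 1)·c₃₅M_jα₀η′ ≤ 2(d+1)c₃₅M_jα₀L^{−k}`, `fit_blockAvgV`); `K_sp = 2(d+1)(d+2)c₃₅`.
[cite: Balaban1985BackgroundPropagators, (3.35) p.396 (the letters at size, shape), (3.52) p.400 (shape); King1986, p.664 (pairing)] -/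
theorem v1SiteSpecies_letters (hL : Odd L ∧ 1 < L) {c35 : ℝ} (hc35 : 0 ≤ c35) {γ : ℝ} (hγ2 : γ ≤ 2) (hφ : ∀ a : 𝔄, |φ a| ≤ ‖a‖) (j : TGIndexS × Fin (d + 1))
    {α₀ : ℝ} (hα₀ : 0 < α₀) (A : (fgInstanceV1GS d 𝔄 ι hL j).Bf.Cfg) (hA : (fgInstanceV1GS d 𝔄 ι hL j).Bf.Reg335 c35 α₀ A) :
    HasMaj (BlockNorm.ofBlocks (unitTorusGeoS L j.1.k (TGIndex.Mn d hL j.1.toTGIndex) j.1.Msz) (blkPair (blockOf (L ^ j.1.k) (TGIndex.Mn d hL j.1.toTGIndex))))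
        (BlockNorm.ofBlocks (unitTorusGeoS L j.1.k (TGIndex.Mn d hL j.1.toTGIndex) j.1.Msz) (blockOf (L ^ j.1.k) (TGIndex.Mn d hL j.1.toTGIndex)))
        (v1SiteSpeciesC d 𝔄 ι φ hL j ((fgInstanceV1GS d 𝔄 ι hL j).pair.avg A)) (diagK fun _ => 2 * ((d : ℝ) + 1) * ((d : ℝ) + 2) * c35 * (j.1.Msz * α₀)) ∧
      HasMaj (BlockNorm.ofBlocks (unitTorusGeoS L j.1.k (TGIndex.Mn d hL j.1.toTGIndex) j.1.Msz)
          (blkPair (blockOf (L ^ j.1.k) (TGIndex.Mn d hL j.1.toTGIndex) ∘ underPtN L j.1.k j.1.m (TGIndex.Mn d hL j.1.toTGIndex))))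
        (BlockNorm.ofBlocks (unitTorusGeoS L j.1.k (TGIndex.Mn d hL j.1.toTGIndex) j.1.Msz)
          (blockOf (L ^ j.1.k) (TGIndex.Mn d hL j.1.toTGIndex) ∘ underPtN L j.1.k j.1.m (TGIndex.Mn d hL j.1.toTGIndex)))
        (v1SiteSpeciesF d 𝔄 ι φ hL j A) (diagK fun _ => 2 * ((d : ℝ) + 1) * ((d : ℝ) + 2) * c35 * (j.1.Msz * α₀)) ∧
      HasMaj (BlockNorm.ofBlocks (unitTorusGeoS L j.1.k (TGIndex.Mn d hL j.1.toTGIndex) j.1.Msz) (blkPair (blockOf (L ^ j.1.k) (TGIndex.Mn d hL j.1.toTGIndex))))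
        (BlockNorm.ofBlocks (unitTorusGeoS L j.1.k (TGIndex.Mn d hL j.1.toTGIndex) j.1.Msz)
          (blockOf (L ^ j.1.k) (TGIndex.Mn d hL j.1.toTGIndex) ∘ underPtN L j.1.k j.1.m (TGIndex.Mn d hL j.1.toTGIndex)))
        (idef (pull (liftPair (underPtN L j.1.k j.1.m (TGIndex.Mn d hL j.1.toTGIndex)))) (pull (underPtN L j.1.k j.1.m (TGIndex.Mn d hL j.1.toTGIndex)))
          (v1SiteSpeciesF d 𝔄 ι φ hL j A) (v1SiteSpeciesC d 𝔄 ι φ hL j ((fgInstanceV1GS d 𝔄 ι hL j).pair.avg A)))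
        (diagK fun _ => 2 * ((d : ℝ) + 1) * ((d : ℝ) + 2) * c35 * (j.1.Msz * α₀) * ((L : ℝ) ^ j.1.k) ^ (-(γ / 2))) := by
  obtain ⟨hA1, hA2, -⟩ := hA
  set M := TGIndex.Mn d hL j.1.toTGIndex with hMdef
  set k := j.1.k with hkdef
  set m := j.1.m with hmdef
  set ν := j.2 with hνdef
  have hL0 : 0 < L := Nat.pos_of_ne_zero (NeZero.ne L)
  have hL1 : (1 : ℝ) ≤ (L : ℝ) := by exact_mod_cast hL0
  have hMsz : 0 ≤ j.1.Msz := le_trans zero_le_one j.1.one_le_Msz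
  have hr : 0 ≤ c35 * (j.1.Msz * α₀) := mul_nonneg hc35 (mul_nonneg hMsz hα₀.le)
  have hd0 : (0 : ℝ) ≤ d := Nat.cast_nonneg d
  have hcard : (Fintype.card (Fin (d + 1)) : ℝ) = (d : ℝ) + 1 := by rw [Fintype.card_fin]; push_cast; ring
  have hθ : 0 ≤ ((L : ℝ) ^ k) ^ (-(γ / 2)) := Real.rpow_nonneg (pow_nonneg (Nat.cast_nonneg _) _) _
  -- the size letter of the gauge field, read as `c₃₅·(M_j·α₀)`; the size field of the carrier is `M_j`
  have hM1 : c35 * (unitTorusGeoS L j.1.k (TGIndex.Mn d hL j.1.toTGIndex) j.1.Msz).M * α₀ = c35 * (j.1.Msz * α₀) := by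
    rw [show (unitTorusGeoS L j.1.k (TGIndex.Mn d hL j.1.toTGIndex) j.1.Msz).M = j.1.Msz from rfl, mul_assoc]
  have hAn : ∀ μ b, ‖A μ b‖ ≤ c35 * (j.1.Msz * α₀) := fun μ b => (hA1 μ b).trans_eq hM1
  have hφA : ∀ μ b, |φ (A μ b)| ≤ c35 * (j.1.Msz * α₀) := fun μ b => (hφ _).trans (hAn μ b)
  -- the size constant `(d+2)r ≤ K_sp·s`
  have hsize : c35 * (j.1.Msz * α₀) * (1 + (Fintype.card (Fin (d + 1)) : ℝ)) ≤ 2 * ((d : ℝ) + 1) * ((d : ℝ) + 2) * c35 * (j.1.Msz * α₀) := by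
    rw [hcard]; nlinarith [mul_nonneg hr hd0, hr]
  have havg : (fgInstanceV1GS d 𝔄 ι hL j).pair.avg A = gavgM 𝔄 (Fin (d + 1)) (kingPrV L k m M) A := rfl
  rw [havg]
  refine ⟨?_, ?_, ?_⟩
  · -- coarse size at the block averages
    have h := hasMaj_unstack (g := unitTorusGeoS L k M j.1.Msz) (blockOf (L ^ k) M) (J := Fin (d + 1)) (c := fun _ => (0 : ℝ))
      (a := fun μ x => φ (gavgM 𝔄 (Fin (d + 1)) (kingPrV L k m M) A μ (x, μ))) hr (fun _ => by rw [abs_zero]; exact hr)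
      (fun μ x => (hφ _).trans (norm_blockAvgV_le _ hr (hAn μ) _))
    exact h.mono fun y y' => diagK_mono (fun _ => hsize) y y'
  · -- fine size
    have h := hasMaj_unstack (g := unitTorusGeoS L k M j.1.Msz) (blockOf (L ^ k) M ∘ underPtN L k m M) (J := Fin (d + 1)) (c := fun _ => (0 : ℝ))
      (a := fun μ x => φ (A μ (x, μ))) hr (fun _ => by rw [abs_zero]; exact hr) (fun μ x => hφA μ _)
    exact h.mono fun y y' => diagK_mono (fun _ => hsize) y y'
  · -- the fit: abelian component of (gauge field − its King block average), within the fibre oscillation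
    have hη : (unitTorusGeoS L j.1.k (TGIndex.Mn d hL j.1.toTGIndex) j.1.Msz).eta * ((unitTorusGeoS L j.1.k (TGIndex.Mn d hL j.1.toTGIndex) j.1.Msz).L ^ m)⁻¹
        = (((L : ℝ) ^ k))⁻¹ * (((L : ℝ) ^ m))⁻¹ := rfl
    have hstep : ∀ μ κ b, ‖A μ (bshiftEquiv M (L ^ m * L ^ k) κ b) - A μ b‖ ≤ c35 * (j.1.Msz * α₀) * ((((L : ℝ) ^ k))⁻¹ * (((L : ℝ) ^ m))⁻¹) := fun μ κ b => by
      have h := hA2 μ κ b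
      rw [hη] at h
      exact h.trans_eq (by rw [show (unitTorusGeoS L j.1.k (TGIndex.Mn d hL j.1.toTGIndex) j.1.Msz).M = j.1.Msz from rfl]; ring)
    -- the oscillation bound `≤ 2(d+1)c₃₅(M_jα₀)·(L^k)^{−γ/2}`
    have hob : ((2 * ((d + 1) * (L ^ m - 1)) : ℕ) : ℝ) * (c35 * (j.1.Msz * α₀) * ((((L : ℝ) ^ k))⁻¹ * (((L : ℝ) ^ m))⁻¹))
        ≤ 2 * ((d : ℝ) + 1) * c35 * (j.1.Msz * α₀) * ((L : ℝ) ^ k) ^ (-(γ / 2)) := by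
      have hLm : (0 : ℝ) < (L : ℝ) ^ m := by positivity
      have hLk : (0 : ℝ) < (L : ℝ) ^ k := by positivity
      have h1 : ((2 * ((d + 1) * (L ^ m - 1)) : ℕ) : ℝ) ≤ 2 * ((d : ℝ) + 1) * (L : ℝ) ^ m := by
        have : ((L ^ m - 1 : ℕ) : ℝ) ≤ ((L ^ m : ℕ) : ℝ) := by exact_mod_cast Nat.sub_le _ _
        push_cast [Nat.cast_sub (Nat.one_le_pow _ _ hL0)] at this ⊢
        nlinarith
      have h2 : (((L : ℝ) ^ k))⁻¹ ≤ ((L : ℝ) ^ k) ^ (-(γ / 2)) := by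
        have := inv_pow_le_rate (L := L) (k := k) hL1 (show γ / 2 ≤ 1 by linarith)
        push_cast at this
        exact this
      calc ((2 * ((d + 1) * (L ^ m - 1)) : ℕ) : ℝ) * (c35 * (j.1.Msz * α₀) * ((((L : ℝ) ^ k))⁻¹ * (((L : ℝ) ^ m))⁻¹))
          ≤ 2 * ((d : ℝ) + 1) * (L : ℝ) ^ m * (c35 * (j.1.Msz * α₀) * ((((L : ℝ) ^ k))⁻¹ * (((L : ℝ) ^ m))⁻¹)) := mul_le_mul_of_nonneg_right h1 (by positivity)
        _ = 2 * ((d : ℝ) + 1) * c35 * (j.1.Msz * α₀) * (((L : ℝ) ^ k))⁻¹ := by field_simp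
        _ ≤ 2 * ((d : ℝ) + 1) * c35 * (j.1.Msz * α₀) * ((L : ℝ) ^ k) ^ (-(γ / 2)) := mul_le_mul_of_nonneg_left h2 (by positivity)
    have ho : 0 ≤ 2 * ((d : ℝ) + 1) * c35 * (j.1.Msz * α₀) * ((L : ℝ) ^ k) ^ (-(γ / 2)) := by positivity
    have hfit : ∀ μ (x' : Tor (fine (L ^ m * L ^ k) M)),
        |φ (A μ (x', μ)) - φ (gavgM 𝔄 (Fin (d + 1)) (kingPrV L k m M) A μ (underPtN L k m M x', μ))| ≤ 2 * ((d : ℝ) + 1) * c35 * (j.1.Msz * α₀) * ((L : ℝ) ^ k) ^ (-(γ / 2)) :=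
      fun μ x' => by
        rw [← map_sub]
        refine (hφ _).trans ((fit_blockAvgV (kingPrV L k m M) (Ω := fun _ => 2 * ((d : ℝ) + 1) * c35 * (j.1.Msz * α₀) * ((L : ℝ) ^ k) ^ (-(γ / 2)))
          (fun x₁' x₂' h => (fibre_conn_kingPrV L k m M (A μ) _ (fun κ i => hstep μ κ i) x₁' x₂' h).trans hob) (x', μ)).trans le_rfl)
    have h := hasMaj_idef_unstack (g := unitTorusGeoS L k M j.1.Msz) (blockOf (L ^ k) M) (J := Fin (d + 1)) (underPtN L k m M)
      (c := fun _ => (0 : ℝ)) (a := fun μ x => φ (gavgM 𝔄 (Fin (d + 1)) (kingPrV L k m M) A μ (x, μ)))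
      (c' := fun _ => (0 : ℝ)) (a' := fun μ x => φ (A μ (x, μ))) ho (fun _ => by rw [sub_zero, abs_zero]; exact ho) hfit
    refine h.mono fun y y' => diagK_mono (fun _ => ?_) y y'
    rw [hcard]; nlinarith [mul_nonneg (mul_nonneg hr hd0) hθ, mul_nonneg hr hθ]

end Letters

/-! ## §3 The sub-index `m ≥ 1`: non-empty and jointly cofinal in (size, scale count) -/

section SubIndex

/-- THE SUB-INDEX of FILE 40's `TGIndexS × Fin (d+1)` with AT LEAST ONE EXTRA SCALE `m ≥ 1`. [bookkeeping] -/
abbrev V1IndexSM (d : ℕ) : Type := {j : TGIndexS × Fin (d + 1) // 1 ≤ j.1.m}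

/-- NON-VACUITY. [folklore] -/
theorem v1IndexSM_nonempty : Nonempty (V1IndexSM d) := ⟨⟨(⟨⟨1, 1, le_rfl, 1⟩, le_rfl, 1, le_rfl⟩, 0), le_rfl⟩⟩

/-- JOINT COFINALITY of size and scale count on the sub-index (as `tgIndexS_cofinal`, with `m := 1`). [folklore] -/
theorem v1IndexSM_cofinal (M₅ : ℝ) (k₀ : ℕ) : ∃ j : V1IndexSM d, M₅ ≤ j.1.1.Msz ∧ k₀ ≤ j.1.1.k :=
  ⟨⟨(⟨⟨1, max k₀ 1, le_max_right _ _, 1⟩, le_rfl, max M₅ 1, le_max_right _ _⟩, 0), le_rfl⟩, le_max_left _ _, le_max_left _ _⟩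

end SubIndex

/-! ## §4 ★★ `NE2PlusSite` with the background live for the sized family (part XI §3 ∘ §2) -/

section Site

omit [CompleteSpace 𝔄] [DecidableEq ι] [Nonempty ι] in
/-- ★★ **`NE2PlusSite` WITH THE BACKGROUND LIVE ON FILE 40's SIZED GAUGE-DRESSED FAMILY** (sub-index `m ≥ 1`): the dressed site kernels of THE massless scalar site propagator, species =
§1, through part XI's sized socket — `d ≥ 0`, odd `L ≥ 3`, `a_S > 0`, `c₃₅ ≥ 0`, `|φ| ≤ ‖·‖`. [cite: Balaban1985BackgroundPropagators, Thm 3.2 (3.48) p.398 + Thm 3.14 pp.426–427 (quantifier template), (3.63)–(3.67) pp.402–403 (mechanism); Balaban1984PropagatorsI, (1.45) p.26; King1986, Prop. 3.8 (3.71) p.664] -/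
theorem ne2PlusSite_v1XAS_site (hLodd : Odd L) (hL2 : 2 ≤ L) (hL : Odd L ∧ 1 < L) {aS : ℝ} (haS : 0 < aS) {c35 : ℝ} (hc35 : 0 ≤ c35) (hφ : ∀ a : 𝔄, |φ a| ≤ ‖a‖) (p : ℝ) :
    NE2PlusSite 4 p c35 (fun j : V1IndexSM d => fgInstanceV1GS d 𝔄 ι hL j.1)
      (sSiteExOn (fun j : V1IndexSM d => TGIndex.Mn d hL j.1.1.toTGIndex) (fun j => j.1.1.k) (fun j => j.1.1.m) (fun j => j.1.1.Msz)
        (fun j => (Tor (fine (L ^ j.1.1.k) (TGIndex.Mn d hL j.1.1.toTGIndex)) × Fin (d + 1)) × ι) (fun j => liftBlk (blkFine L j.1.1.k (TGIndex.Mn d hL j.1.1.toTGIndex)) ι)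
        (fun j => (fgInstanceV1GS d 𝔄 ι hL j.1).gf) (fun j => (fgInstanceV1GS d 𝔄 ι hL j.1).Bc) (fun j => (fgInstanceV1GS d 𝔄 ι hL j.1).Bf) aS
        (fun j => (fgInstanceV1GS d 𝔄 ι hL j.1).pair) (fun j A => v1SitePertF d 𝔄 ι φ hL aS j.1 A) (fun j B => v1SitePertC d 𝔄 ι φ hL aS j.1 B)) :=
  ne2PlusSite_sSiteExOn_of_sizedSpeciesLetters (L := L) (fun j : V1IndexSM d => TGIndex.Mn d hL j.1.1.toTGIndex) (fun j => j.1.1.k) (fun j => j.1.1.m) (fun j => j.1.1.Msz)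
    (fun j => (Tor (fine (L ^ j.1.1.k) (TGIndex.Mn d hL j.1.1.toTGIndex)) × Fin (d + 1)) × ι) (fun j => liftBlk (blkFine L j.1.1.k (TGIndex.Mn d hL j.1.1.toTGIndex)) ι)
    (fun j => (fgInstanceV1GS d 𝔄 ι hL j.1).gf) (fun j => (fgInstanceV1GS d 𝔄 ι hL j.1).Bc) (fun j => (fgInstanceV1GS d 𝔄 ι hL j.1).Bf)
    (fun j => v1SiteSpeciesC d 𝔄 ι φ hL j.1) (fun j => v1SiteSpeciesF d 𝔄 ι φ hL j.1) hLodd hL2 haS c35 4 p one_half_pos (by norm_num) (mT := fun j => j.1.1.mT)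
    (fun _ _ => rfl) (fun j => j.1.1.one_le) (fun j => j.2) (fun j => j.1.1.one_le_Msz) (fun j => (fgInstanceV1GS d 𝔄 ι hL j.1).pair)
    ⟨2 * ((d : ℝ) + 1) * ((d : ℝ) + 2) * c35, 1, by positivity, one_pos, fun j α₀ hα₀ _ A hA => v1SiteSpecies_letters d 𝔄 ι φ hL hc35 (by norm_num) hφ j.1 hα₀ A hA⟩

end Site

/-! ## §5 ★★★ `Live ∧ N15At` with operator AND site layers reading the background -/

section Knit

/-- ★★★ **`N15At` FOR THE SIZED GAUGE-DRESSED FAMILY WITH OPERATOR AND SITE LAYERS READING THE BACKGROUND** (sub-index `m ≥ 1`): OPERATOR = FILE 40 `fgFamilyV1XAS` (S-E `n15At_v1XAS`'s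
first conjunct, reindexed), SITE = §4, UNIT = S-E's `v1CovS` (third conjunct, reindexed; U-blind). `d ≥ 1`, odd `L ≥ 3`, `b, a_S, c₃₅ > 0`. [bookkeeping] -/
theorem n15At_v1XAS_site (hd : 1 ≤ d) (hLodd : Odd L) (hL2 : 2 ≤ L) (hL : Odd L ∧ 1 < L) {b aS c35 : ℝ} (hb : 0 < b) (haS : 0 < aS) (hc35 : 0 < c35)
    (hφ : ∀ a : 𝔄, |φ a| ≤ ‖a‖) (α β : Fin (d + 1)) (p : ℝ) :
    N15At { I := V1IndexSM d, c35 := c35, p := p, pi := fun j => fgInstanceV1GS d 𝔄 ι hL j.1, Kop := fun j => fgFamilyV1XAS d 𝔄 ι e hL b j.1,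
            Ksite := sSiteExOn (fun j : V1IndexSM d => TGIndex.Mn d hL j.1.1.toTGIndex) (fun j => j.1.1.k) (fun j => j.1.1.m) (fun j => j.1.1.Msz)
              (fun j => (Tor (fine (L ^ j.1.1.k) (TGIndex.Mn d hL j.1.1.toTGIndex)) × Fin (d + 1)) × ι) (fun j => liftBlk (blkFine L j.1.1.k (TGIndex.Mn d hL j.1.1.toTGIndex)) ι)
              (fun j => (fgInstanceV1GS d 𝔄 ι hL j.1).gf) (fun j => (fgInstanceV1GS d 𝔄 ι hL j.1).Bc) (fun j => (fgInstanceV1GS d 𝔄 ι hL j.1).Bf) aS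
              (fun j => (fgInstanceV1GS d 𝔄 ι hL j.1).pair) (fun j A => v1SitePertF d 𝔄 ι φ hL aS j.1 A) (fun j B => v1SitePertC d 𝔄 ι φ hL aS j.1 B),
            Kunit := fun j => v1CovS d 𝔄 ι hL α β j.1, inΛ := fun _ _ => True, unitDist := fun j => (fgInstanceV1GS d 𝔄 ι hL j.1).gc.dist } := by
  have h := n15At_v1XAS 𝔄 ι e hd hLodd hL2 hL hb haS hc35 α β p
  exact ⟨ne2PlusOperator_reindex (fun j : V1IndexSM d => j.1) h.1, ne2PlusSite_v1XAS_site d 𝔄 ι φ hLodd hL2 hL haS hc35.le hφ p,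
    ne2PlusUnit_reindex (fun j : V1IndexSM d => j.1) h.2.2⟩

omit [CompleteSpace 𝔄] [DecidableEq ι] [Nonempty ι] in
/-- ★★ **THE FAMILY PASSES THE K3⁷ GUARD** (`PairedFamilyGuard.Live`, FOR THESE KERNELS): size ∕ scale count jointly cofinal on the sub-index (`v1IndexSM_cofinal`), trivial gauge field
regular at every `α₀ > 0` (`reg_zero_fgInstanceV1GS`) — S-D `live_opGeoS`. [bookkeeping] -/
theorem live_v1XAS_site (hL : Odd L ∧ 1 < L) {c35 : ℝ} (hc35 : 0 ≤ c35) (p : ℝ)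
    (Kop : ∀ j : V1IndexSM d, B9.KernelFamily (fgInstanceV1GS d 𝔄 ι hL j.1).gc (fgInstanceV1GS d 𝔄 ι hL j.1).Bf)
    (Ksite Kunit : ∀ j : V1IndexSM d, B9.SiteKernel (fgInstanceV1GS d 𝔄 ι hL j.1).gc (fgInstanceV1GS d 𝔄 ι hL j.1).Bf) :
    Live ⟨V1IndexSM d, c35, p, fun j => fgInstanceV1GS d 𝔄 ι hL j.1, Kop, Ksite, Kunit, fun _ _ => True, fun j => (fgInstanceV1GS d 𝔄 ι hL j.1).gc.dist⟩ :=
  live_opGeoS (d := d) hL (fun j : V1IndexSM d => j.1.1.toTGIndex) (fun j => j.1.1.Msz)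
    (fun j => (Tor (fine (L ^ j.1.1.k) (TGIndex.Mn d hL j.1.1.toTGIndex)) × Fin (d + 1)) × ι)
    (fun j => liftBlk (blkFine L j.1.1.k (TGIndex.Mn d hL j.1.1.toTGIndex)) ι)
    (fun j => (fgInstanceV1GS d 𝔄 ι hL j.1).gf) (fun j => (fgInstanceV1GS d 𝔄 ι hL j.1).Bc) (fun j => (fgInstanceV1GS d 𝔄 ι hL j.1).Bf)
    (fun j => (fgInstanceV1GS d 𝔄 ι hL j.1).pair) c35 p Kop Ksite Kunit (v1IndexSM_cofinal (d := d))
    (fun j α₀ hα₀ => reg_zero_fgInstanceV1GS d 𝔄 ι hL hc35 j.1 α₀ hα₀)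

/-- ★★★ **GUARD ∧ `N15At` — A `Live` SIZE-LIVE FAMILY WITH TWO LAYERS READING THE BACKGROUND** (operator: FILE 40's (3.52) species; site: §1's species on THE massless scalar site propagator;
unit U-blind): `d ≥ 1`, odd `L ≥ 3`, `b, a_S, c₃₅ > 0`, `|φ| ≤ ‖·‖`. [bookkeeping] -/
theorem live_and_n15At_v1XAS_site (hd : 1 ≤ d) (hLodd : Odd L) (hL2 : 2 ≤ L) (hL : Odd L ∧ 1 < L) {b aS c35 : ℝ} (hb : 0 < b) (haS : 0 < aS) (hc35 : 0 < c35)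
    (hφ : ∀ a : 𝔄, |φ a| ≤ ‖a‖) (α β : Fin (d + 1)) (p : ℝ) :
    Live ⟨V1IndexSM d, c35, p, fun j => fgInstanceV1GS d 𝔄 ι hL j.1, fun j => fgFamilyV1XAS d 𝔄 ι e hL b j.1,
        sSiteExOn (fun j : V1IndexSM d => TGIndex.Mn d hL j.1.1.toTGIndex) (fun j => j.1.1.k) (fun j => j.1.1.m) (fun j => j.1.1.Msz)
          (fun j => (Tor (fine (L ^ j.1.1.k) (TGIndex.Mn d hL j.1.1.toTGIndex)) × Fin (d + 1)) × ι) (fun j => liftBlk (blkFine L j.1.1.k (TGIndex.Mn d hL j.1.1.toTGIndex)) ι)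
          (fun j => (fgInstanceV1GS d 𝔄 ι hL j.1).gf) (fun j => (fgInstanceV1GS d 𝔄 ι hL j.1).Bc) (fun j => (fgInstanceV1GS d 𝔄 ι hL j.1).Bf) aS
          (fun j => (fgInstanceV1GS d 𝔄 ι hL j.1).pair) (fun j A => v1SitePertF d 𝔄 ι φ hL aS j.1 A) (fun j B => v1SitePertC d 𝔄 ι φ hL aS j.1 B),
        fun j => v1CovS d 𝔄 ι hL α β j.1, fun _ _ => True, fun j => (fgInstanceV1GS d 𝔄 ι hL j.1).gc.dist⟩ ∧
      N15At { I := V1IndexSM d, c35 := c35, p := p, pi := fun j => fgInstanceV1GS d 𝔄 ι hL j.1, Kop := fun j => fgFamilyV1XAS d 𝔄 ι e hL b j.1,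
              Ksite := sSiteExOn (fun j : V1IndexSM d => TGIndex.Mn d hL j.1.1.toTGIndex) (fun j => j.1.1.k) (fun j => j.1.1.m) (fun j => j.1.1.Msz)
                (fun j => (Tor (fine (L ^ j.1.1.k) (TGIndex.Mn d hL j.1.1.toTGIndex)) × Fin (d + 1)) × ι) (fun j => liftBlk (blkFine L j.1.1.k (TGIndex.Mn d hL j.1.1.toTGIndex)) ι)
                (fun j => (fgInstanceV1GS d 𝔄 ι hL j.1).gf) (fun j => (fgInstanceV1GS d 𝔄 ι hL j.1).Bc) (fun j => (fgInstanceV1GS d 𝔄 ι hL j.1).Bf) aS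
                (fun j => (fgInstanceV1GS d 𝔄 ι hL j.1).pair) (fun j A => v1SitePertF d 𝔄 ι φ hL aS j.1 A) (fun j B => v1SitePertC d 𝔄 ι φ hL aS j.1 B),
              Kunit := fun j => v1CovS d 𝔄 ι hL α β j.1, inΛ := fun _ _ => True, unitDist := fun j => (fgInstanceV1GS d 𝔄 ι hL j.1).gc.dist } :=
  ⟨live_v1XAS_site d 𝔄 ι hL hc35.le p _ _ _, n15At_v1XAS_site d 𝔄 ι e φ hd hLodd hL2 hL hb haS hc35 hφ α β p⟩

end Knit

/-! ## §6 The `NE2Objects₁₁` literal of the two-layers-U-seeing sized family and its faces (S-E §4's pattern) -/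

section Record

/-- **N15's NE2 OBJECTS OF THE SIZED GAUGE-DRESSED FAMILY WITH OPERATOR AND SITE LAYERS READING THE BACKGROUND** (RR-1's layer-A container): S-E's `v1XASObjects` on the sub-index
`m ≥ 1` with the site kernel the DRESSED site socket `sSiteExOn` at §1's perturbations. [bookkeeping] -/
def v1XASiteObjects (hL : Odd L ∧ 1 < L) (b aS : ℝ) (α β : Fin (d + 1)) (c35 p : ℝ) : Node00.NE2Objects₁₁ where
  I := V1IndexSM d
  c35 := c35
  p := p
  pi := fun j => fgInstanceV1GS d 𝔄 ι hL j.1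
  Kop := fun j => fgFamilyV1XAS d 𝔄 ι e hL b j.1
  Ksite := sSiteExOn (fun j : V1IndexSM d => TGIndex.Mn d hL j.1.1.toTGIndex) (fun j => j.1.1.k) (fun j => j.1.1.m) (fun j => j.1.1.Msz)
    (fun j => (Tor (fine (L ^ j.1.1.k) (TGIndex.Mn d hL j.1.1.toTGIndex)) × Fin (d + 1)) × ι) (fun j => liftBlk (blkFine L j.1.1.k (TGIndex.Mn d hL j.1.1.toTGIndex)) ι)
    (fun j => (fgInstanceV1GS d 𝔄 ι hL j.1).gf) (fun j => (fgInstanceV1GS d 𝔄 ι hL j.1).Bc) (fun j => (fgInstanceV1GS d 𝔄 ι hL j.1).Bf) aS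
    (fun j => (fgInstanceV1GS d 𝔄 ι hL j.1).pair) (fun j A => v1SitePertF d 𝔄 ι φ hL aS j.1 A) (fun j B => v1SitePertC d 𝔄 ι φ hL aS j.1 B)
  Kunit := fun j => v1CovS d 𝔄 ι hL α β j.1
  inΛ := fun _ _ => True
  unitDist := fun j => (fgInstanceV1GS d 𝔄 ι hL j.1).gc.dist

variable {d}

/-- ★★★ **`Live ∧ N15At` AT THE OBJECTS' BUNDLE** (`d ≥ 1`, odd `L ≥ 3`, `b, a_S, c₃₅ > 0`, `|φ| ≤ ‖·‖`). [bookkeeping] -/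
theorem live_and_n15At_v1XASiteObjects (hd : 1 ≤ d) (hLodd : Odd L) (hL2 : 2 ≤ L) (hL : Odd L ∧ 1 < L) {b aS c35 : ℝ} (hb : 0 < b) (haS : 0 < aS) (hc35 : 0 < c35)
    (hφ : ∀ a : 𝔄, |φ a| ≤ ‖a‖) (α β : Fin (d + 1)) (p : ℝ) :
    Live (ne2OfRecord₁₁ (v1XASiteObjects d 𝔄 ι e φ hL b aS α β c35 p)) ∧ N15At (ne2OfRecord₁₁ (v1XASiteObjects d 𝔄 ι e φ hL b aS α β c35 p)) :=
  live_and_n15At_v1XAS_site d 𝔄 ι e φ hd hLodd hL2 hL hb haS hc35 hφ α β p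

omit [CompleteSpace 𝔄] [Nonempty ι] in
/-- RR-1's display: the objects are `Populated`. [bookkeeping] -/
theorem populated_v1XASiteObjects (hL : Odd L ∧ 1 < L) (b aS : ℝ) (α β : Fin (d + 1)) (c35 p : ℝ) : (v1XASiteObjects d 𝔄 ι e φ hL b aS α β c35 p).Populated :=
  (Node00.NE2Objects₁₁.populated_iff _).2 (v1IndexSM_nonempty d)

/-- `Live ∧ N15At` at the family-keyed literal (`d + 1 = 4`, the datum's own block factor `F.L`). [bookkeeping] -/
theorem live_and_n15At_v1XASiteObjects_family {b aS c35 : ℝ} (hb : 0 < b) (haS : 0 < aS) (hc35 : 0 < c35) (hφ : ∀ a : 𝔄, |φ a| ≤ ‖a‖) (α β : Fin 4) (p : ℝ) (F : T4Family) :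
    Live (ne2OfRecord₁₁ (haveI := neZero_blockFactor F; v1XASiteObjects 3 𝔄 ι e φ F.hL b aS α β c35 p)) ∧
      N15At (ne2OfRecord₁₁ (haveI := neZero_blockFactor F; v1XASiteObjects 3 𝔄 ι e φ F.hL b aS α β c35 p)) := by
  haveI := neZero_blockFactor F
  exact live_and_n15At_v1XASiteObjects (d := 3) 𝔄 ι e φ (by norm_num) F.hL.1 (two_le_L F) F.hL hb haS hc35 hφ α β p

variable {N : ℕ} [NeZero N] {key : (F : T4Family) → Datum F N → Prop}

/-- ★★ **THE FAMILY-KEYED READING CLOSES THE STUB AT ANY KEYED HOME** (part 30's interface, S-E's pattern; `d + 1 = 4`, the datum's own block factor): a home admitting only the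
literals of a key-indexed NE2 reading whose value everywhere IS `v1XASiteObjects 3 …` has `S_N15 RRec` — the estimate is §5, not a hypothesis. [bookkeeping] -/
theorem s_N15_of_admits_v1XASite_family {b aS c35 : ℝ} (hb : 0 < b) (haS : 0 < aS) (hc35 : 0 < c35) (hφ : ∀ a : 𝔄, |φ a| ≤ ‖a‖) (α β : Fin 4) (p : ℝ)
    (ne2At : ∀ {F : T4Family} {D : Datum F N}, key F D → (ℕ → ℝ) → List (ULoop F) → ℕ → Node00.NE2Objects₁₁) (RRec : RateRecordPred N)
    (hadm : ∀ (F : T4Family) (D : Datum F N) (g₀ : ℕ → ℝ) (os : List (ULoop F)) (R : RateCarriers N), RRec F D g₀ os R →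
      ∃ (h : key F D) (k : ℕ), R.ne2 = ne2OfRecord₁₁ (ne2At h g₀ os k))
    (h : ∀ (F : T4Family) (D : Datum F N) (h : key F D) (g₀ : ℕ → ℝ) (os : List (ULoop F)) (k : ℕ),
      ne2At h g₀ os k = haveI := neZero_blockFactor F; v1XASiteObjects 3 𝔄 ι e φ F.hL b aS α β c35 p) :
    S_N15 RRec := by
  refine s_N15_of_admits ne2At RRec hadm fun F D hk g₀ os k => ?_
  rw [h F D hk g₀ os k]
  exact (live_and_n15At_v1XASiteObjects_family 𝔄 ι e φ hb haS hc35 hφ α β p F).2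

end Record

end Summit.QuantumFields.YangMills.BalabanUVNodes.N15.SiteLayerBg

end
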